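import Summits.BirchSwinnertonDyer.BirchSwinnertonDyer.Theorems.QuadraticBranchSignedControlPlusEtaNonsurjConjADoorEigen
import Summits.BirchSwinnertonDyer.BirchSwinnertonDyer.Theorems.SignedLowerHalvesSprungLowerDivisibilityAtThreeControlAtT
import Summits.BirchSwinnertonDyer.Rank1Residual.X11b.ChaPairsMinimality
import HarnessLib

/-!
# Route `QuadraticBranchSignedControl` (rung K8, cell `bsd-potss`), residual crux `PlusEtaMainConjectureNonsurj`
# (stmt-BirchSwinnertonDyer-19606): RECORDS THROUGH DOOR L2 — (C1⁺_η) at `p = 5` on the four prime-`L` rank-one rows of the k8eta-c2 g21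
# census decided by the PLAIN eigen-test «`2` is not an eigenvalue of `σ₂` on `Cl(ℚ(P)) ⊗ 𝔽₅`», one of them NON-CM (seat `bsd-potss-k8eta-c2` g21;
# kit j326603, GRH)

WHAT. `…ConjADoorEigen` (`EtaConjADoorEigen.conjA_partner_of_eigenHom`, the K8 wrapper of conjA-anchor g17's fact-free eigen door, and its
fine-road composition `quadraticBranchPlusEtaMainConjectureAt_of_eigenHom_of_span_eq_span_X`) gives (C1⁺_η) on the prime-`L` rank-`1` shape
from the ROW ALONE: named facts `h22 h41 h6273` (Kobayashi 2003) + `hGZK` (`Sel_{5^∞}(W/ℚ)` infinite from `r_an(W) = 1`); displayed per row: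
`r_an(W) = 1`, the tower clause, the shape `(L_5⁺(V,η,X)) = (X)` (PARI `λ⁺ = 1, μ⁺ = 0`) and the plain tautological eigen datum on `Cl(ℚ(P)) ⊗ 𝔽₅`
for one `P ∈ W[5] ∖ 0` (every additive `μ : Cl(𝓞_{ℚ(P)}) → ℤ/5` with `μ[σ̄I] = a•μ[I]` whenever `τ|_{ℚ(P)} = σ̄`, `τ•P = a•P` vanishes). §1 the
row-generic form `etaMC_r1_of_eigenHom`; §2 the four in-table rows of the k8eta-c2 g21 classification (`E5-CLASSIFICATION-k8eta-c2-g21.tsv`, door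
`PASS:L2`, prime-`L` rank-one shape): `5 ∣ h(ℚ(P))` (the plain class-number door is void), door L6⁻ void, eigen dimensions `(d₁, d₂, d₃, d₄) = (0, 0, 1, 0)`
(the `5`-part of `Cl(ℚ(P))` is ONE class with `σ₂`-eigenvalue `3`, not tautological): `112225a1 = [0,0,1,−184250,30441031]` (CM, `h/hₓ = 10/1`),
`297675cj1 = [0,0,1,0,−96469]` (CM, `80/2`), **`313200el1 = [0,0,0,−705375,−135465750]` (NON-CM, `30/3`)**, `456300ee1 = [0,0,0,0,3570125]` (CM, `90/18`);
Cremona `r_an(W) = 1`, PARI plus-`η` `(λ, μ) = (1, 0)` on each (g20 QP5-ROADS / g21 E5-CLASSIFICATION).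

HONEST FRAMING (cell `bsd-potss`; FULL-BSD rank ≤ 1 programme, HUMAN RULING D-0036/D-0074): per-row RECORDS, CONDITIONAL on the displayed named
facts and per-row inputs; the class-group / eigen data are GRH numerics (evidence, not facts); no stub of 19606 is proved by name; the crux stays
OPEN; nothing is booked; `BSD(W,5)` is claimed for no pair. `--supports stmt-BirchSwinnertonDyer-19606`.

References: [Kobayashi2003] §4 (p. 8), Thm. 4.1, Thm. 2.2, Thm. 7.3 i); [CoatesSujatha2005] §3 (A), Thm. 3.4; [DeoRaySujatha2023] Thm. 3.8; [GrossZagier1986]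
Thm. (7.3); [Kolyvagin1990] Thm. A; [Cremona1997] Table 1 (labels as listed).
-/

set_option autoImplicit false
set_option linter.dupNamespace false
noncomputable section

open scoped Classical nonZeroDivisors

open CongruenceSubgroup NumberField Field WeierstrassCurve
open Literature.NumberTheory.EllipticCurves Literature.NumberTheory.EllipticCurves.ModularForms
  Literature.NumberTheory.EllipticCurves.Rank1Residual Literature.NumberTheory.EllipticCurves.Rank1Residual.Typed
  Literature.NumberTheory.GaloisRepresentations Literature.NumberTheory.GaloisCohomology Literature.NumberTheory.NumberFields
  Literature.NumberTheory.EllipticCurves.GreenbergVatsal2000 ZpExtension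
open Summit.BirchSwinnertonDyer.Rank1Residual Summit.BirchSwinnertonDyer.Rank1Residual.Additive
open Summit.BirchSwinnertonDyer.Rank1Residual.X11b (isElliptic_of_discOf_ne_zero)
open Summit.BirchSwinnertonDyer.BirchSwinnertonDyer.Theorems

namespace Summit.BirchSwinnertonDyer.BirchSwinnertonDyer.Theorems.EtaConjADoorEigenRecords

/-! ## §1 Row-generic form -/

/-- **(C1⁺_η) on a prime-`L` rank-one row from the PLAIN eigen datum** (row-generic record shape): `W/ℚ` elliptic with `r_an(W) = 1`, `p ≥ 5`,
`V` a globally minimal good `a_p = 0` model of `W^{(p*)}` whose `p`-adic tower is not onto, `(L_p⁺(V,η,X)) = (X)`, and one `P ∈ W[p] ∖ 0` on whose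
stabiliser field `K = ℚ(P)` every additive `μ : Cl(𝓞_K) → ℤ/p` with the tautological relations vanishes ⟹ `QuadraticBranchPlusEtaMainConjectureAt V p`.
Named facts `h22 h41 h6273 hGZK`; `EtaConjADoorEigen.quadraticBranchPlusEtaMainConjectureAt_of_eigenHom_of_span_eq_span_X` with `Sel_{p^∞}(W/ℚ)`
infinite from `r_an = 1` (`ChromaticCommonZerosControlAtT.not_finite_selmerGroupPInfty_of_analyticRank_eq_one`). CONDITIONAL; nothing booked.
[cite: Kobayashi2003, §4 Even main conjecture (p. 8)] [cite: CoatesSujatha2005, §3 Thm. 3.4] [cite: GrossZagier1986, Thm. (7.3)] [cite: Kolyvagin1990, Thm. A] -/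
theorem etaMC_r1_of_eigenHom
    (h22 : Kobayashi2003.thm22_etaSignedSelmerDual_finite_torsion)
    (h41 : Kobayashi2003.thm41_plusEtaCharIdeal_dvd)
    (h6273 : Kobayashi2003.thm62_63_73_etaColemanPoitouTate)
    (hGZK : rank_eq_analyticRank_of_analyticRank_le_one)
    (p : ℕ) [Fact p.Prime] [NeZero p] (hp5 : 5 ≤ p)
    (W : WeierstrassCurve ℚ) [W.IsElliptic] (hr : W.analyticRank = 1)
    (V : WeierstrassCurve ℚ) [V.IsElliptic] [V.IsGloballyMinimal] (C : VariableChange ℚ)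
    (hC : C • W.quadraticTwist ((-1) ^ (p / 2) * p) = V)
    (hgood : V.HasGoodReductionAtPrime p) (hap : V.frobeniusTrace p = 0)
    (hns : ¬ ∀ m : ℕ, V.HasSurjectiveModNGaloisRep (p ^ m : ℕ))
    (hX : ∀ {N : ℕ} [NeZero N] {f : CuspForm (Gamma0 N) 2}, IsNewformOf V f →
      ∀ (ϖ : ℚ), (if Even (p / 2) then (ϖ : ℝ) * V.realPeriodRat = plusPeriod f
          else (ϖ : ℝ) * V.imaginaryPeriodRat = minusPeriod f) →
      ∀ (Lη : IwasawaAlgebra p), IsQuadraticBranchPlusLFunction f p ϖ Lη →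
        Ideal.span {Lη} = Ideal.span {(PowerSeries.X : IwasawaAlgebra p)})
    (hP : haveI : NumberField (W.divisionField p) := NumberField.mk
      ∃ P : geomTorsion W (p : ℤ), P ≠ 0 ∧
        ∀ K : IntermediateField ℚ (W.divisionField p),
          K = IntermediateField.fixedField
            ((MulAction.stabilizer (absoluteGaloisGroup ℚ) P).map (absRestrictNormalHom (W.divisionField p))) →
        ∀ μ : Additive (ClassGroup (𝓞 K)) →+ ZMod p,
          (∀ (τ : absoluteGaloisGroup ℚ) (σ : K ≃ₐ[ℚ] K) (a : ℕ),
              (∀ x : K, absRestrictNormalHom (W.divisionField p) τ (x : W.divisionField p) =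
                ((σ x : K) : W.divisionField p)) → τ • P = a • P →
              ∀ (I J : (Ideal (𝓞 K))⁰),
                (J : Ideal (𝓞 K)) = (I : Ideal (𝓞 K)).map (AmbiguousClass.intAut σ : 𝓞 K →+* 𝓞 K) →
                μ (Additive.ofMul (ClassGroup.mk0 J)) = a • μ (Additive.ofMul (ClassGroup.mk0 I))) →
          μ = 0) :
    QuadraticBranchPlusEtaMainConjectureAt V p :=
  EtaConjADoorEigen.quadraticBranchPlusEtaMainConjectureAt_of_eigenHom_of_span_eq_span_X p V W C h22 h41 h6273 hp5 hC
    hgood hap hns (ChromaticCommonZerosControlAtT.not_finite_selmerGroupPInfty_of_analyticRank_eq_one hGZK W p hr) hX hP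

/-! ## §2 The four prime-`L` rank-one rows decided by door L2 -/

/-- `112225a1` = `[0, 0, 1, -184250, 30441031]` (CM, `N = 112225`): `Δ ≠ 0` (kernel). [cite: Cremona1997, Table 1 (label 112225a1)] -/
theorem isElliptic_112225a1 : (⟨0, 0, 1, (-184250), 30441031⟩ : WeierstrassCurve ℚ).IsElliptic :=
  isElliptic_of_discOf_ne_zero 0 0 1 (-184250) 30441031 (by decide +kernel)

/-- **(C1⁺_η) at `p = 5` for every good `a_5 = 0` model `V` of the `5`-twist of `112225a1`** (`W = [0, 0, 1, -184250, 30441031]`, CM, `N = 112225`;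
Cremona `r_an(W) = 1`; PARI plus-`η` `(λ, μ) = (1, 0)`; census j326603 (GRH): `h(ℚ(P)) = 10`, `h(ℚ(x(P))) = 1`, `(d₁,d₂,d₃,d₄) = (0,0,1,0)` — the plain class-number door and door L6⁻ are
VOID, door L2 passes: `2` is not an eigenvalue of `σ₂` on `Cl(ℚ(P)) ⊗ 𝔽₅`) from the ROW ALONE — named facts `h22 h41 h6273 hGZK`; displayed
`r_an(W) = 1`, the tower clause, `(L_5⁺(V,η,X)) = (X)`, the eigen datum. Instance of `etaMC_r1_of_eigenHom`. CONDITIONAL; nothing booked.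
[cite: Kobayashi2003, §4 (p. 8)] [cite: CoatesSujatha2005, §3 Thm. 3.4] [cite: Cremona1997, Table 1 (label 112225a1)] -/
theorem etaMC_r1_112225a1_5_of_eigenHom
    (h22 : Kobayashi2003.thm22_etaSignedSelmerDual_finite_torsion)
    (h41 : Kobayashi2003.thm41_plusEtaCharIdeal_dvd)
    (h6273 : Kobayashi2003.thm62_63_73_etaColemanPoitouTate)
    (hGZK : rank_eq_analyticRank_of_analyticRank_le_one) [Fact (5 : ℕ).Prime]
    (W : WeierstrassCurve ℚ) (hW : W = (⟨0, 0, 1, (-184250), 30441031⟩ : WeierstrassCurve ℚ)) (hr : W.analyticRank = 1)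
    (V : WeierstrassCurve ℚ) [V.IsElliptic] [V.IsGloballyMinimal] (C : VariableChange ℚ)
    (hC : C • W.quadraticTwist 5 = V)
    (hgood : V.HasGoodReductionAtPrime 5) (hap : V.frobeniusTrace 5 = 0)
    (hns : ¬ ∀ m : ℕ, V.HasSurjectiveModNGaloisRep (5 ^ m : ℕ))
    (hX : ∀ {N : ℕ} [NeZero N] {f : CuspForm (Gamma0 N) 2}, IsNewformOf V f →
      ∀ (ϖ : ℚ), (if Even (5 / 2) then (ϖ : ℝ) * V.realPeriodRat = plusPeriod f
          else (ϖ : ℝ) * V.imaginaryPeriodRat = minusPeriod f) →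
      ∀ (Lη : IwasawaAlgebra 5), IsQuadraticBranchPlusLFunction f 5 ϖ Lη →
        Ideal.span {Lη} = Ideal.span {(PowerSeries.X : IwasawaAlgebra 5)})
    (hP : haveI : W.IsElliptic := hW ▸ isElliptic_112225a1
      haveI : NeZero (5 : ℕ) := ⟨by norm_num⟩
      haveI : NumberField (W.divisionField 5) := NumberField.mk
      ∃ P : geomTorsion W ((5 : ℕ) : ℤ), P ≠ 0 ∧
        ∀ K : IntermediateField ℚ (W.divisionField 5),
          K = IntermediateField.fixedField
            ((MulAction.stabilizer (absoluteGaloisGroup ℚ) P).map (absRestrictNormalHom (W.divisionField 5))) →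
        ∀ μ : Additive (ClassGroup (𝓞 K)) →+ ZMod 5,
          (∀ (τ : absoluteGaloisGroup ℚ) (σ : K ≃ₐ[ℚ] K) (a : ℕ),
              (∀ x : K, absRestrictNormalHom (W.divisionField 5) τ (x : W.divisionField 5) =
                ((σ x : K) : W.divisionField 5)) → τ • P = a • P →
              ∀ (I J : (Ideal (𝓞 K))⁰),
                (J : Ideal (𝓞 K)) = (I : Ideal (𝓞 K)).map (AmbiguousClass.intAut σ : 𝓞 K →+* 𝓞 K) →
                μ (Additive.ofMul (ClassGroup.mk0 J)) = a • μ (Additive.ofMul (ClassGroup.mk0 I))) →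
          μ = 0) :
    QuadraticBranchPlusEtaMainConjectureAt V 5 := by
  subst hW
  haveI : (⟨0, 0, 1, (-184250), 30441031⟩ : WeierstrassCurve ℚ).IsElliptic := isElliptic_112225a1
  haveI : NeZero (5 : ℕ) := ⟨by norm_num⟩
  exact etaMC_r1_of_eigenHom h22 h41 h6273 hGZK 5 (le_refl 5) _ hr V C
    (by rw [show ((-1 : ℚ) ^ ((5 : ℕ) / 2) * ((5 : ℕ) : ℚ)) = 5 by norm_num]; exact hC) hgood hap hns hX hP

/-- `297675cj1` = `[0, 0, 1, 0, -96469]` (CM, `j = 0`, `N = 297675`): `Δ ≠ 0` (kernel). [cite: Cremona1997, Table 1 (label 297675cj1)] -/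
theorem isElliptic_297675cj1 : (⟨0, 0, 1, 0, (-96469)⟩ : WeierstrassCurve ℚ).IsElliptic :=
  isElliptic_of_discOf_ne_zero 0 0 1 0 (-96469) (by decide +kernel)

/-- **(C1⁺_η) at `p = 5` for every good `a_5 = 0` model `V` of the `5`-twist of `297675cj1`** (`W = [0, 0, 1, 0, -96469]`, CM, `j = 0`, `N = 297675`;
Cremona `r_an(W) = 1`; PARI plus-`η` `(λ, μ) = (1, 0)`; census j326603 (GRH): `h(ℚ(P)) = 80`, `h(ℚ(x(P))) = 2`, `(d₁,d₂,d₃,d₄) = (0,0,1,0)` — the plain class-number door and door L6⁻ are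
VOID, door L2 passes: `2` is not an eigenvalue of `σ₂` on `Cl(ℚ(P)) ⊗ 𝔽₅`) from the ROW ALONE — named facts `h22 h41 h6273 hGZK`; displayed
`r_an(W) = 1`, the tower clause, `(L_5⁺(V,η,X)) = (X)`, the eigen datum. Instance of `etaMC_r1_of_eigenHom`. CONDITIONAL; nothing booked.
[cite: Kobayashi2003, §4 (p. 8)] [cite: CoatesSujatha2005, §3 Thm. 3.4] [cite: Cremona1997, Table 1 (label 297675cj1)] -/
theorem etaMC_r1_297675cj1_5_of_eigenHom
    (h22 : Kobayashi2003.thm22_etaSignedSelmerDual_finite_torsion)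
    (h41 : Kobayashi2003.thm41_plusEtaCharIdeal_dvd)
    (h6273 : Kobayashi2003.thm62_63_73_etaColemanPoitouTate)
    (hGZK : rank_eq_analyticRank_of_analyticRank_le_one) [Fact (5 : ℕ).Prime]
    (W : WeierstrassCurve ℚ) (hW : W = (⟨0, 0, 1, 0, (-96469)⟩ : WeierstrassCurve ℚ)) (hr : W.analyticRank = 1)
    (V : WeierstrassCurve ℚ) [V.IsElliptic] [V.IsGloballyMinimal] (C : VariableChange ℚ)
    (hC : C • W.quadraticTwist 5 = V)
    (hgood : V.HasGoodReductionAtPrime 5) (hap : V.frobeniusTrace 5 = 0)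
    (hns : ¬ ∀ m : ℕ, V.HasSurjectiveModNGaloisRep (5 ^ m : ℕ))
    (hX : ∀ {N : ℕ} [NeZero N] {f : CuspForm (Gamma0 N) 2}, IsNewformOf V f →
      ∀ (ϖ : ℚ), (if Even (5 / 2) then (ϖ : ℝ) * V.realPeriodRat = plusPeriod f
          else (ϖ : ℝ) * V.imaginaryPeriodRat = minusPeriod f) →
      ∀ (Lη : IwasawaAlgebra 5), IsQuadraticBranchPlusLFunction f 5 ϖ Lη →
        Ideal.span {Lη} = Ideal.span {(PowerSeries.X : IwasawaAlgebra 5)})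
    (hP : haveI : W.IsElliptic := hW ▸ isElliptic_297675cj1
      haveI : NeZero (5 : ℕ) := ⟨by norm_num⟩
      haveI : NumberField (W.divisionField 5) := NumberField.mk
      ∃ P : geomTorsion W ((5 : ℕ) : ℤ), P ≠ 0 ∧
        ∀ K : IntermediateField ℚ (W.divisionField 5),
          K = IntermediateField.fixedField
            ((MulAction.stabilizer (absoluteGaloisGroup ℚ) P).map (absRestrictNormalHom (W.divisionField 5))) →
        ∀ μ : Additive (ClassGroup (𝓞 K)) →+ ZMod 5,
          (∀ (τ : absoluteGaloisGroup ℚ) (σ : K ≃ₐ[ℚ] K) (a : ℕ),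
              (∀ x : K, absRestrictNormalHom (W.divisionField 5) τ (x : W.divisionField 5) =
                ((σ x : K) : W.divisionField 5)) → τ • P = a • P →
              ∀ (I J : (Ideal (𝓞 K))⁰),
                (J : Ideal (𝓞 K)) = (I : Ideal (𝓞 K)).map (AmbiguousClass.intAut σ : 𝓞 K →+* 𝓞 K) →
                μ (Additive.ofMul (ClassGroup.mk0 J)) = a • μ (Additive.ofMul (ClassGroup.mk0 I))) →
          μ = 0) :
    QuadraticBranchPlusEtaMainConjectureAt V 5 := by
  subst hW
  haveI : (⟨0, 0, 1, 0, (-96469)⟩ : WeierstrassCurve ℚ).IsElliptic := isElliptic_297675cj1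
  haveI : NeZero (5 : ℕ) := ⟨by norm_num⟩
  exact etaMC_r1_of_eigenHom h22 h41 h6273 hGZK 5 (le_refl 5) _ hr V C
    (by rw [show ((-1 : ℚ) ^ ((5 : ℕ) / 2) * ((5 : ℕ) : ℚ)) = 5 by norm_num]; exact hC) hgood hap hns hX hP

/-- `313200el1` = `[0, 0, 0, -705375, -135465750]` (NON-CM, `N = 313200`): `Δ ≠ 0` (kernel). [cite: Cremona1997, Table 1 (label 313200el1)] -/
theorem isElliptic_313200el1 : (⟨0, 0, 0, (-705375), (-135465750)⟩ : WeierstrassCurve ℚ).IsElliptic :=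
  isElliptic_of_discOf_ne_zero 0 0 0 (-705375) (-135465750) (by decide +kernel)

/-- **(C1⁺_η) at `p = 5` for every good `a_5 = 0` model `V` of the `5`-twist of `313200el1`** (`W = [0, 0, 0, -705375, -135465750]`, NON-CM, `N = 313200`;
Cremona `r_an(W) = 1`; PARI plus-`η` `(λ, μ) = (1, 0)`; census j326603 (GRH): `h(ℚ(P)) = 30`, `h(ℚ(x(P))) = 3`, `(d₁,d₂,d₃,d₄) = (0,0,1,0)` — the plain class-number door and door L6⁻ are
VOID, door L2 passes: `2` is not an eigenvalue of `σ₂` on `Cl(ℚ(P)) ⊗ 𝔽₅`) from the ROW ALONE — named facts `h22 h41 h6273 hGZK`; displayed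
`r_an(W) = 1`, the tower clause, `(L_5⁺(V,η,X)) = (X)`, the eigen datum. Instance of `etaMC_r1_of_eigenHom`. CONDITIONAL; nothing booked.
[cite: Kobayashi2003, §4 (p. 8)] [cite: CoatesSujatha2005, §3 Thm. 3.4] [cite: Cremona1997, Table 1 (label 313200el1)] -/
theorem etaMC_r1_313200el1_5_of_eigenHom
    (h22 : Kobayashi2003.thm22_etaSignedSelmerDual_finite_torsion)
    (h41 : Kobayashi2003.thm41_plusEtaCharIdeal_dvd)
    (h6273 : Kobayashi2003.thm62_63_73_etaColemanPoitouTate)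
    (hGZK : rank_eq_analyticRank_of_analyticRank_le_one) [Fact (5 : ℕ).Prime]
    (W : WeierstrassCurve ℚ) (hW : W = (⟨0, 0, 0, (-705375), (-135465750)⟩ : WeierstrassCurve ℚ)) (hr : W.analyticRank = 1)
    (V : WeierstrassCurve ℚ) [V.IsElliptic] [V.IsGloballyMinimal] (C : VariableChange ℚ)
    (hC : C • W.quadraticTwist 5 = V)
    (hgood : V.HasGoodReductionAtPrime 5) (hap : V.frobeniusTrace 5 = 0)
    (hns : ¬ ∀ m : ℕ, V.HasSurjectiveModNGaloisRep (5 ^ m : ℕ))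
    (hX : ∀ {N : ℕ} [NeZero N] {f : CuspForm (Gamma0 N) 2}, IsNewformOf V f →
      ∀ (ϖ : ℚ), (if Even (5 / 2) then (ϖ : ℝ) * V.realPeriodRat = plusPeriod f
          else (ϖ : ℝ) * V.imaginaryPeriodRat = minusPeriod f) →
      ∀ (Lη : IwasawaAlgebra 5), IsQuadraticBranchPlusLFunction f 5 ϖ Lη →
        Ideal.span {Lη} = Ideal.span {(PowerSeries.X : IwasawaAlgebra 5)})
    (hP : haveI : W.IsElliptic := hW ▸ isElliptic_313200el1
      haveI : NeZero (5 : ℕ) := ⟨by norm_num⟩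
      haveI : NumberField (W.divisionField 5) := NumberField.mk
      ∃ P : geomTorsion W ((5 : ℕ) : ℤ), P ≠ 0 ∧
        ∀ K : IntermediateField ℚ (W.divisionField 5),
          K = IntermediateField.fixedField
            ((MulAction.stabilizer (absoluteGaloisGroup ℚ) P).map (absRestrictNormalHom (W.divisionField 5))) →
        ∀ μ : Additive (ClassGroup (𝓞 K)) →+ ZMod 5,
          (∀ (τ : absoluteGaloisGroup ℚ) (σ : K ≃ₐ[ℚ] K) (a : ℕ),
              (∀ x : K, absRestrictNormalHom (W.divisionField 5) τ (x : W.divisionField 5) =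
                ((σ x : K) : W.divisionField 5)) → τ • P = a • P →
              ∀ (I J : (Ideal (𝓞 K))⁰),
                (J : Ideal (𝓞 K)) = (I : Ideal (𝓞 K)).map (AmbiguousClass.intAut σ : 𝓞 K →+* 𝓞 K) →
                μ (Additive.ofMul (ClassGroup.mk0 J)) = a • μ (Additive.ofMul (ClassGroup.mk0 I))) →
          μ = 0) :
    QuadraticBranchPlusEtaMainConjectureAt V 5 := by
  subst hW
  haveI : (⟨0, 0, 0, (-705375), (-135465750)⟩ : WeierstrassCurve ℚ).IsElliptic := isElliptic_313200el1
  haveI : NeZero (5 : ℕ) := ⟨by norm_num⟩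
  exact etaMC_r1_of_eigenHom h22 h41 h6273 hGZK 5 (le_refl 5) _ hr V C
    (by rw [show ((-1 : ℚ) ^ ((5 : ℕ) / 2) * ((5 : ℕ) : ℚ)) = 5 by norm_num]; exact hC) hgood hap hns hX hP

/-- `456300ee1` = `[0, 0, 0, 0, 3570125]` (CM, `j = 0`, `N = 456300`): `Δ ≠ 0` (kernel). [cite: Cremona1997, Table 1 (label 456300ee1)] -/
theorem isElliptic_456300ee1 : (⟨0, 0, 0, 0, 3570125⟩ : WeierstrassCurve ℚ).IsElliptic :=
  isElliptic_of_discOf_ne_zero 0 0 0 0 3570125 (by decide +kernel)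

/-- **(C1⁺_η) at `p = 5` for every good `a_5 = 0` model `V` of the `5`-twist of `456300ee1`** (`W = [0, 0, 0, 0, 3570125]`, CM, `j = 0`, `N = 456300`;
Cremona `r_an(W) = 1`; PARI plus-`η` `(λ, μ) = (1, 0)`; census j326603 (GRH): `h(ℚ(P)) = 90`, `h(ℚ(x(P))) = 18`, `(d₁,d₂,d₃,d₄) = (0,0,1,0)` — the plain class-number door and door L6⁻ are
VOID, door L2 passes: `2` is not an eigenvalue of `σ₂` on `Cl(ℚ(P)) ⊗ 𝔽₅`) from the ROW ALONE — named facts `h22 h41 h6273 hGZK`; displayed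
`r_an(W) = 1`, the tower clause, `(L_5⁺(V,η,X)) = (X)`, the eigen datum. Instance of `etaMC_r1_of_eigenHom`. CONDITIONAL; nothing booked.
[cite: Kobayashi2003, §4 (p. 8)] [cite: CoatesSujatha2005, §3 Thm. 3.4] [cite: Cremona1997, Table 1 (label 456300ee1)] -/
theorem etaMC_r1_456300ee1_5_of_eigenHom
    (h22 : Kobayashi2003.thm22_etaSignedSelmerDual_finite_torsion)
    (h41 : Kobayashi2003.thm41_plusEtaCharIdeal_dvd)
    (h6273 : Kobayashi2003.thm62_63_73_etaColemanPoitouTate)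
    (hGZK : rank_eq_analyticRank_of_analyticRank_le_one) [Fact (5 : ℕ).Prime]
    (W : WeierstrassCurve ℚ) (hW : W = (⟨0, 0, 0, 0, 3570125⟩ : WeierstrassCurve ℚ)) (hr : W.analyticRank = 1)
    (V : WeierstrassCurve ℚ) [V.IsElliptic] [V.IsGloballyMinimal] (C : VariableChange ℚ)
    (hC : C • W.quadraticTwist 5 = V)
    (hgood : V.HasGoodReductionAtPrime 5) (hap : V.frobeniusTrace 5 = 0)
    (hns : ¬ ∀ m : ℕ, V.HasSurjectiveModNGaloisRep (5 ^ m : ℕ))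
    (hX : ∀ {N : ℕ} [NeZero N] {f : CuspForm (Gamma0 N) 2}, IsNewformOf V f →
      ∀ (ϖ : ℚ), (if Even (5 / 2) then (ϖ : ℝ) * V.realPeriodRat = plusPeriod f
          else (ϖ : ℝ) * V.imaginaryPeriodRat = minusPeriod f) →
      ∀ (Lη : IwasawaAlgebra 5), IsQuadraticBranchPlusLFunction f 5 ϖ Lη →
        Ideal.span {Lη} = Ideal.span {(PowerSeries.X : IwasawaAlgebra 5)})
    (hP : haveI : W.IsElliptic := hW ▸ isElliptic_456300ee1
      haveI : NeZero (5 : ℕ) := ⟨by norm_num⟩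
      haveI : NumberField (W.divisionField 5) := NumberField.mk
      ∃ P : geomTorsion W ((5 : ℕ) : ℤ), P ≠ 0 ∧
        ∀ K : IntermediateField ℚ (W.divisionField 5),
          K = IntermediateField.fixedField
            ((MulAction.stabilizer (absoluteGaloisGroup ℚ) P).map (absRestrictNormalHom (W.divisionField 5))) →
        ∀ μ : Additive (ClassGroup (𝓞 K)) →+ ZMod 5,
          (∀ (τ : absoluteGaloisGroup ℚ) (σ : K ≃ₐ[ℚ] K) (a : ℕ),
              (∀ x : K, absRestrictNormalHom (W.divisionField 5) τ (x : W.divisionField 5) =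
                ((σ x : K) : W.divisionField 5)) → τ • P = a • P →
              ∀ (I J : (Ideal (𝓞 K))⁰),
                (J : Ideal (𝓞 K)) = (I : Ideal (𝓞 K)).map (AmbiguousClass.intAut σ : 𝓞 K →+* 𝓞 K) →
                μ (Additive.ofMul (ClassGroup.mk0 J)) = a • μ (Additive.ofMul (ClassGroup.mk0 I))) →
          μ = 0) :
    QuadraticBranchPlusEtaMainConjectureAt V 5 := by
  subst hW
  haveI : (⟨0, 0, 0, 0, 3570125⟩ : WeierstrassCurve ℚ).IsElliptic := isElliptic_456300ee1
  haveI : NeZero (5 : ℕ) := ⟨by norm_num⟩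
  exact etaMC_r1_of_eigenHom h22 h41 h6273 hGZK 5 (le_refl 5) _ hr V C
    (by rw [show ((-1 : ℚ) ^ ((5 : ℕ) / 2) * ((5 : ℕ) : ℚ)) = 5 by norm_num]; exact hC) hgood hap hns hX hP

end Summit.BirchSwinnertonDyer.BirchSwinnertonDyer.Theorems.EtaConjADoorEigenRecords

end
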